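import Mathlib
import HarnessLib
import Summits.HubbardSuperconductivity.HubbardSuperconductivity.Theorems.KLProgrammeKLRegimeEngineScaleZeroE4Geometry

/-!
# Route `KLProgramme` — ENGINE item stmt-HubbardSuperconductivity-20437, class #6 / (E5-F)ₙ producer, route (M) ((α-0) memo): the NEAR COUNT of the
# near/far split — the number of space-time points within `spaceTimeDist`-distance `R` of a pinned point is `≤ (2R/ε + 2)·(2R + 2)²`

Cell gate-hubbard-kl, seat hubbard-kl-k3c2-p2 (g10).  `…EngineFixedTupleNearFar.fixedTupleL1_le_near_add_far` (route (M), (V1′) skeleton) takes a bound `N_R` on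
`#{y : spaceTimeDist L M β x₁ y < R}`; here it is, in closed form, for the cell's space-time torus `SpaceTimeIdx L M = Fin 2M × (ℤ/L)²` with its `ℓ^∞`-type distance
`spaceTimeDist = max (ε·circDist_{2M}(x₀,y₀), circDist_L, circDist_L)` (`ε = imagTimeWeight β M`):

* §1 `card_filter_val_sub_lt_le`, `card_filter_cyclic_lt_le` — on `ℤ/N`: `#{z : val(z − a) < D} ≤ ⌊D⌋₊ + 1` and `#{z : min(val(z−a), val(a−z)) < D} ≤ 2(⌊D⌋₊ + 1)`;
* §2 `card_timeBall_le` (`#{t : Fin 2M | ε·circDist_{2M}(x₀,t) < R} ≤ 2(⌊R/ε⌋₊ + 1)`), `card_coordBall_le` (`#{u : ℤ/L | circDist_L(c,u) < R} ≤ 2(⌊R⌋₊ + 1)`);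
* §3 **`card_spaceTimeBall_le`** — `#{y | spaceTimeDist L M β x₁ y < R} ≤ 2(⌊R/ε⌋₊+1)·(2(⌊R⌋₊+1))²`, and the real form **`card_spaceTimeBall_le_real`**:
  `≤ (2R/ε + 2)·(2R + 2)²` (`β > 0`, `R ≥ 0`) — so the near term of the split is `ε^m·N_R^m·B ≤ ((2R + 2ε)(2R+2)²)^m·B`: for `R ≍ ρ/Λ` the dual-box volume `≍ ρ³/(ε… )`
  that (M)'s duality count `(c₀ρ)⁹` (three free legs) refers to.

Everything is proved; no definitions; nothing about the model is asserted.
-/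

noncomputable section

namespace Summit.HubbardSuperconductivity.HubbardSuperconductivity.Theorems.EngineV8

set_option linter.dupNamespace false -- summit = problem name (single-conjunct summit), D-0017

open Classical
open Real Finset Literature.MathematicalPhysics.QuantumLattice Literature.Probability.LatticeModels
open Summit.HubbardSuperconductivity.HubbardSuperconductivity.Theorems.KLRegimeSplit

/-! ## §1 Cyclic balls in `ℤ/N` -/

/-- `#{z : ℤ/N | val(z − a) < D} ≤ ⌊D⌋₊ + 1` (the map `z ↦ val(z − a)` is injective into `{0, …, ⌊D⌋₊}`). -/
theorem card_filter_val_sub_lt_le {N : ℕ} [NeZero N] (a : ZMod N) (D : ℝ) :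
    ((univ : Finset (ZMod N)).filter fun z => (((z - a).val : ℕ) : ℝ) < D).card ≤ ⌊D⌋₊ + 1 := by
  have h := Finset.card_le_card_of_injOn (s := (univ : Finset (ZMod N)).filter fun z => (((z - a).val : ℕ) : ℝ) < D)
    (t := range (⌊D⌋₊ + 1)) (fun z => (z - a).val) (fun z hz => ?_) (fun z₁ _ z₂ _ h12 => ?_)
  · simpa using h
  · have hz' : (((z - a).val : ℕ) : ℝ) < D := (mem_filter.1 (mem_coe.1 hz)).2
    rw [mem_coe, mem_range]
    have : (z - a).val ≤ ⌊D⌋₊ := Nat.le_floor hz'.le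
    exact Nat.lt_succ_of_le this
  · have h' : z₁ - a = z₂ - a := ZMod.val_injective N h12
    exact sub_left_injective h'

/-- `#{z : ℤ/N | min(val(z − a), val(a − z)) < D} ≤ 2(⌊D⌋₊ + 1)` (union of the two one-sided balls). -/
theorem card_filter_cyclic_lt_le {N : ℕ} [NeZero N] (a : ZMod N) (D : ℝ) :
    ((univ : Finset (ZMod N)).filter fun z => ((min (z - a).val (a - z).val : ℕ) : ℝ) < D).card ≤ 2 * (⌊D⌋₊ + 1) := by
  have hsub : ((univ : Finset (ZMod N)).filter fun z => ((min (z - a).val (a - z).val : ℕ) : ℝ) < D) ⊆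
      ((univ : Finset (ZMod N)).filter fun z => (((z - a).val : ℕ) : ℝ) < D) ∪
        ((univ : Finset (ZMod N)).filter fun z => (((a - z).val : ℕ) : ℝ) < D) := by
    intro z hz
    rw [mem_filter] at hz
    rw [mem_union, mem_filter, mem_filter]
    rcases min_choice (z - a).val (a - z).val with h | h
    · left; exact ⟨mem_univ _, by rw [h] at hz; exact hz.2⟩
    · right; exact ⟨mem_univ _, by rw [h] at hz; exact hz.2⟩
  -- the second ball is the first one centred at `a` for the map `z ↦ a - z`… bound it directly by the same injection
  have h2 : ((univ : Finset (ZMod N)).filter fun z => (((a - z).val : ℕ) : ℝ) < D).card ≤ ⌊D⌋₊ + 1 := by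
    have h := Finset.card_le_card_of_injOn (s := (univ : Finset (ZMod N)).filter fun z => (((a - z).val : ℕ) : ℝ) < D)
      (t := range (⌊D⌋₊ + 1)) (fun z => (a - z).val) (fun z hz => ?_) (fun z₁ _ z₂ _ h12 => ?_)
    · simpa using h
    · have hz' : (((a - z).val : ℕ) : ℝ) < D := (mem_filter.1 (mem_coe.1 hz)).2
      rw [mem_coe, mem_range]
      have : (a - z).val ≤ ⌊D⌋₊ := Nat.le_floor hz'.le
      exact Nat.lt_succ_of_le this
    · have h' : a - z₁ = a - z₂ := ZMod.val_injective N h12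
      exact sub_right_injective h'
  calc _ ≤ (((univ : Finset (ZMod N)).filter fun z => (((z - a).val : ℕ) : ℝ) < D) ∪
        ((univ : Finset (ZMod N)).filter fun z => (((a - z).val : ℕ) : ℝ) < D)).card := card_le_card hsub
    _ ≤ _ := card_union_le _ _
    _ ≤ (⌊D⌋₊ + 1) + (⌊D⌋₊ + 1) := Nat.add_le_add (card_filter_val_sub_lt_le a D) h2
    _ = 2 * (⌊D⌋₊ + 1) := by ring

/-! ## §2 Time and coordinate balls -/

/-- **Time ball**: `#{t : Fin 2M | ε·circDist_{2M}(x₀, t) < R} ≤ 2(⌊R/ε⌋₊ + 1)` for `ε > 0`. -/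
theorem card_timeBall_le {M : ℕ} [NeZero M] (x₀ : ImagTimeIdx M) {ε R : ℝ} (hε : 0 < ε) :
    ((univ : Finset (ImagTimeIdx M)).filter fun t => ε * (circDist (2 * M) x₀.val t.val : ℝ) < R).card ≤ 2 * (⌊R / ε⌋₊ + 1) := by
  haveI : NeZero (2 * M) := ⟨by have := NeZero.ne M; omega⟩
  set a : ZMod (2 * M) := ((x₀.val : ℕ) : ZMod (2 * M)) with ha
  -- inject `t ↦ (t.val : ZMod 2M)` into the cyclic ball of radius `R/ε` around `a`
  have h := Finset.card_le_card_of_injOn (s := (univ : Finset (ImagTimeIdx M)).filter fun t => ε * (circDist (2 * M) x₀.val t.val : ℝ) < R)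
    (t := (univ : Finset (ZMod (2 * M))).filter fun z => ((min (z - a).val (a - z).val : ℕ) : ℝ) < R / ε)
    (fun t => ((t.val : ℕ) : ZMod (2 * M))) (fun t ht => ?_) (fun t₁ _ t₂ _ h12 => ?_)
  · exact h.trans (card_filter_cyclic_lt_le a (R / ε))
  · have ht' : ε * (circDist (2 * M) x₀.val t.val : ℝ) < R := (mem_filter.1 (mem_coe.1 ht)).2
    rw [mem_coe, mem_filter]
    refine ⟨mem_univ _, ?_⟩
    rw [lt_div_iff₀ hε, mul_comm]
    have hcd : circDist (2 * M) x₀.val t.val = min ((((t.val : ℕ) : ZMod (2 * M)) - a).val) ((a - ((t.val : ℕ) : ZMod (2 * M))).val) := by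
      rw [circDist_eq_min_val, ha, min_comm]
    rw [← hcd]
    exact ht'
  · have hv := congr_arg ZMod.val h12
    simp only [ZMod.val_natCast] at hv
    rw [Nat.mod_eq_of_lt t₁.isLt, Nat.mod_eq_of_lt t₂.isLt] at hv
    exact Fin.ext hv

/-- **Coordinate ball**: `#{u : ℤ/L | circDist_L(c, u) < R} ≤ 2(⌊R⌋₊ + 1)`. -/
theorem card_coordBall_le {L : ℕ} [NeZero L] (c : ZMod L) (R : ℝ) :
    ((univ : Finset (ZMod L)).filter fun u => (circDist L c.val u.val : ℝ) < R).card ≤ 2 * (⌊R⌋₊ + 1) := by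
  have heq : ((univ : Finset (ZMod L)).filter fun u => (circDist L c.val u.val : ℝ) < R) =
      ((univ : Finset (ZMod L)).filter fun z => ((min (z - c).val (c - z).val : ℕ) : ℝ) < R) := by
    refine filter_congr fun u _ => ?_
    rw [circDist_val_eq, min_comm]
  rw [heq]
  exact card_filter_cyclic_lt_le c R

/-! ## §3 The space-time ball -/

/-- **The space-time ball count**: `#{y : SpaceTimeIdx L M | spaceTimeDist L M β x₁ y < R} ≤ 2(⌊R/ε⌋₊+1)·(2(⌊R⌋₊+1))²` (`ε = imagTimeWeight β M > 0`). -/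
theorem card_spaceTimeBall_le {L M : ℕ} [NeZero L] [NeZero M] {β : ℝ} (hβ : 0 < β) (x₁ : SpaceTimeIdx L M) (R : ℝ) :
    ((univ : Finset (SpaceTimeIdx L M)).filter fun y => spaceTimeDist L M β x₁ y < R).card ≤
      2 * (⌊R / imagTimeWeight β M⌋₊ + 1) * (2 * (⌊R⌋₊ + 1)) ^ 2 := by
  have hMr : (0 : ℝ) < M := Nat.cast_pos.2 (Nat.pos_of_ne_zero (NeZero.ne M))
  have hε : 0 < imagTimeWeight β M := by unfold imagTimeWeight; positivity
  set T := (univ : Finset (ImagTimeIdx M)).filter fun t => imagTimeWeight β M * (circDist (2 * M) x₁.1.val t.val : ℝ) < R with hT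
  set S : Finset (TorusSite 2 L) := Fintype.piFinset fun i : Fin 2 => (univ : Finset (ZMod L)).filter fun u =>
      (circDist L (x₁.2 i).val u.val : ℝ) < R with hS
  have hsub : ((univ : Finset (SpaceTimeIdx L M)).filter fun y => spaceTimeDist L M β x₁ y < R) ⊆ T ×ˢ S := by
    intro y hy
    have hy' : spaceTimeDist L M β x₁ y < R := (mem_filter.1 hy).2
    unfold KLRegimeSplit.spaceTimeDist at hy'
    rw [max_lt_iff, max_lt_iff] at hy'
    rw [mem_product, hT, mem_filter, hS, Fintype.mem_piFinset]
    refine ⟨⟨mem_univ _, hy'.1⟩, fun i => mem_filter.2 ⟨mem_univ _, ?_⟩⟩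
    fin_cases i
    · exact hy'.2.1
    · exact hy'.2.2
  calc _ ≤ (T ×ˢ S).card := card_le_card hsub
    _ = T.card * S.card := card_product _ _
    _ ≤ 2 * (⌊R / imagTimeWeight β M⌋₊ + 1) * (2 * (⌊R⌋₊ + 1)) ^ 2 := by
        refine Nat.mul_le_mul (card_timeBall_le x₁.1 hε) ?_
        rw [hS, Fintype.card_piFinset]
        calc ∏ i : Fin 2, ((univ : Finset (ZMod L)).filter fun u => (circDist L (x₁.2 i).val u.val : ℝ) < R).card
            ≤ ∏ _i : Fin 2, 2 * (⌊R⌋₊ + 1) := prod_le_prod (fun i _ => Nat.zero_le _) (fun i _ => card_coordBall_le _ R)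
          _ = (2 * (⌊R⌋₊ + 1)) ^ 2 := by rw [prod_const, card_univ, Fintype.card_fin]

/-- **Real form of the ball count**: `#{y | spaceTimeDist L M β x₁ y < R} ≤ (2R/ε + 2)·(2R + 2)²` (`β > 0`, `R ≥ 0`, `ε = imagTimeWeight β M`). -/
theorem card_spaceTimeBall_le_real {L M : ℕ} [NeZero L] [NeZero M] {β : ℝ} (hβ : 0 < β) (x₁ : SpaceTimeIdx L M) {R : ℝ} (hR : 0 ≤ R) :
    ((((univ : Finset (SpaceTimeIdx L M)).filter fun y => spaceTimeDist L M β x₁ y < R).card : ℕ) : ℝ) ≤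
      (2 * R / imagTimeWeight β M + 2) * (2 * R + 2) ^ 2 := by
  have hMr : (0 : ℝ) < M := Nat.cast_pos.2 (Nat.pos_of_ne_zero (NeZero.ne M))
  have hε : 0 < imagTimeWeight β M := by unfold imagTimeWeight; positivity
  have h := card_spaceTimeBall_le hβ x₁ R
  have h1 : ((⌊R / imagTimeWeight β M⌋₊ : ℕ) : ℝ) ≤ R / imagTimeWeight β M := Nat.floor_le (by positivity)
  have h2 : ((⌊R⌋₊ : ℕ) : ℝ) ≤ R := Nat.floor_le hR
  calc ((((univ : Finset (SpaceTimeIdx L M)).filter fun y => spaceTimeDist L M β x₁ y < R).card : ℕ) : ℝ)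
      ≤ ((2 * (⌊R / imagTimeWeight β M⌋₊ + 1) * (2 * (⌊R⌋₊ + 1)) ^ 2 : ℕ) : ℝ) := by exact_mod_cast h
    _ = (2 * ((⌊R / imagTimeWeight β M⌋₊ : ℕ) : ℝ) + 2) * (2 * ((⌊R⌋₊ : ℕ) : ℝ) + 2) ^ 2 := by push_cast; ring
    _ ≤ (2 * (R / imagTimeWeight β M) + 2) * (2 * R + 2) ^ 2 := by gcongr
    _ = (2 * R / imagTimeWeight β M + 2) * (2 * R + 2) ^ 2 := by ring

end Summit.HubbardSuperconductivity.HubbardSuperconductivity.Theorems.EngineV8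

end
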